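import Literature.IUT.HodgeTheaters.PiAvatarKitCoreThetaOfBadPairs
import Literature.IUT.HodgeTheaters.PiAvatarKitCoreGluing
import Literature.IUT.HodgeTheaters.KitNFSideProp67
import Literature.IUT.HodgeTheaters.PMBaseProp67AlgorithmSub
import HarnessLib

/-!
# [IUTchI] Proposition 6.7 AS PRINTED at the genuine-shape Θ-NF kit WITH PARAMETRIC BAD-PAIR DATA: the functorial algorithm
# `𝒟-Θ^±-bridge ↦ 𝒟-Θ-bridge` «as in Definition 4.6, (ii)», «well-defined, up to a unique isomorphism», over the NAMED core
# `kitCoreThetaOfBadPairs B ΛBad ES` (node IUTchI:Prop6.7, UPGRADE row «PROP67-EX44-AT-OFBADPAIRS», file 2 of 3; proof-only)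

S. Mochizuki, *Inter-universal Teichmüller theory I*, kurims manuscript (May 2020): Proposition 6.7 p. 167 l. 22–33 («… by replacing the
various +-full poly-morphisms that occur in `†φ^{Θ±}_±` at the `v ∈ 𝕍^bad` by the poly-morphisms described [via group-theoretic algorithms!]
in Example 4.4, (i), (ii), we obtain a functorial algorithm for constructing a [well-defined, up to a unique isomorphism!] `𝒟-Θ`-bridge
`†φ^Θ_⋇ : †𝔇_{T^⋇} → †𝔇_>` as in Definition 4.6, (ii)»), Definition 4.6 (ii) p. 111, Example 4.4 (i)(ii)(iv) pp. 106–107, Proposition 4.8 (ii)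
p. 115, Definition 6.1 (i) p. 156, Example 6.2 (i) p. 160. ([IUTchI] Prop 6.7 p.167) [claim: Mochizuki2012, status: disputed] (D-0012 claim key,
series status DISPUTED — kernel theorems over abc-iut-L5-t2's REAL `InitialThetaData` and abc-iut-L5-t4's genuine-shape Θ-NF kit
`baseKitThetaNFOfBadPairs CG hS M hA hI B ΛBad` (ambient `ThetaAmb`, p462621/p465512); nothing of the series is asserted, no side is taken on
[IUTchIII] Cor. 3.12).

## What this file proves and why (abc-iut-L5-lead g8 L5 ROWS #1 2026-08-27T03:05:03Z: UPGRADE row «PROP67-EX44-AT-OFBADPAIRS»)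

abc-iut-w4-d054's `PiAvatarKitCoreThetaProp67` (p487254) proved Proposition 6.7 — Def 4.6 (ii) as typed in §4, the kit reading, the printed
labelling, the `isModel` clause, «well-defined up to a UNIQUE isomorphism» (`Nat.card (Hom) = 1`), the agreement of the two readings, and the
non-vacuity of the `∀ 𝒟-Θ^±-bridge` quantifier — at the §4 datum of the Θ-NF STAND-IN kit, i.e. with the bad-pair data FIXED to the `X̲→`-recipe
`B := badPairAtArrow hA`.  THIS FILE is the SAME list of theorems, with the SAME one-line proofs from the kit-general closers of record
(abc-iut-w4-d054 `PMBaseThetaBridgeProofs` p412223; abc-iut-L5-t3 `KitCoreBridgeProp67` / `KitCoreThetaBridge` p417112; abc-iut-w5-d228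
`PMBaseProp67AlgorithmSub`; `KitNFSideProp67` p430384), at the §4 datum `baseThetaDatumThetaOfBadPairs B ΛBad ES` over the genuine-shape Θ-NF kit
with PARAMETRIC bad-pair DATA `B : ∀ v̲ ∈ V̲^bad, BadPairAt v̲` and its laws `ΛBad` (file 1 of this row, `PiAvatarKitCoreThetaOfBadPairs`: datum,
FROZEN `KitCore` `kitCoreThetaOfBadPairs`, law (γ) `thetaAgrees_thetaOfBadPairs`), modulo exactly the DISPLAYED binders
{`CG`, `hS`, `M`, `hA`, `hI`} (kit) ∪ {`B`, `ΛBad`} (bad-pair DATA with LAWS) ∪ {`ES`} (evaluation sections at `localDataOfBadPairs`) and NOTHING ELSE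
(no `KitCore`/`ThetaAgrees`/`hsat`/`hrig`/`hbad` hypothesis — all are theorems here).  The stand-in theorems of p487254 are the special case
`B := badPairAtArrow hA` (file 1's `baseThetaDatumThetaStandIn_eq_ofBadPairs`, `rfl`); nothing of p487254 is restated under its names.
Theorem list: `thetaBridgeAlgorithm_thetaOfBadPairs`, `thetaBridgeAlgorithm_isModelConjugate_thetaOfBadPairs`,
`thetaBridgeData_poly_eq_modelThetaBridge_thetaOfBadPairs`, `thetaBridgeData_isModel_thetaOfBadPairs`, `thetaBridgeData_hom_nonempty_thetaOfBadPairs`,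
`card_thetaBridgeData_hom_thetaOfBadPairs` (`Nat.card = 1`), `isModelConjugate_iff_exists_dThetaBridge_thetaOfBadPairs`,
`nonempty_dThetaPMBridge_thetaOfBadPairs`, `exists_dThetaBridge_ex62_thetaOfBadPairs`, `exists_kitCore_thetaAgrees_thetaBridgeAlgorithm_thetaOfBadPairs`.
HONEST TAG (carried): «instance forms at OUR Θ-NF ambient (`ThetaAmb`: `¬IsIso` by tag; PRICE IN FAITHFULNESS recorded in p462621's docstring)»;
a datum over OUR interface witnesses OUR binders only and is NOT print's tempered `ℬ^temp(X̳_v̲)⁰`; the bad-pair data `B` are DATA of OUR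
`BadPairAt` interface with LAWS `ΛBad` — parametric, not constructed here.  Everything is by NAME; proof-only (no `def`, no instance, no
notation, no new binder, no `Prop` fact); every `theorem` is kernel-checked; typed ≠ inhabited ≠ proved; binder ≠ fact.
-/

noncomputable section

namespace Literature.IUT.HodgeTheaters

open CategoryTheory

universe u v w

section KitCoreThetaOfBadPairsProp67

variable {F : Type u} {K : Type v} {Fbar : Type w} [Field F] [NumberField F] [Field K] [NumberField K]
  [Algebra F K] [Field Fbar] [Algebra F Fbar] [Algebra K Fbar]
  {E : WeierstrassCurve F} [E.IsElliptic] {l : ℕ} {Pb : BadPlacePredicates K}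
  (D : InitialThetaData F K Fbar E l Pb) (CG : D.geom.pe.CuspGalois) (hS : D.CuspClassesNormaliserStable) [Fact l.Prime]
  (M : D.TorsionMonodromy) (hA : D.geom.pe.ArrowCoveringClaims)
  (hI : ∀ k ∈ D.geom.pe.inertia D.geom.pe.ε1, M.tau (D.geom.embK k) = 0)

namespace InitialThetaData

variable (B : ∀ v, v ∈ D.indexCopyBad → D.BadPairAt v) (ΛBad : ∀ v (h : v ∈ D.indexCopyBad), D.LocalArrowLaw CG hS (B v h).H)
  {Gv : D.IndexCopy → Subgroup (Fbar ≃ₐ[F] Fbar)}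
  (ES : ∀ v, v ∈ D.indexCopyBad → EvalSectionBinder (D.localDataOfBadPairs CG hS M hA hI B ΛBad v) (Gv v))

/-! ### §0. Bookkeeping: the dictionary at the NAMED core is the identity -/

/-- (bookkeeping) Through the core `kitCoreThetaOfBadPairs B ΛBad ES` (file 1 of this row) (= `KitCore.ofKit`, the identity dictionary) the transport
`f ↦ ambModel⁻¹ ∘ amb(f) ∘ ambModel` of an endomorphism of `𝒟_v̲` is `f` itself read in the Θ-NF ambient (`amb = ι`, `ambModel = Iso.refl`;
abc-iut-w4-d054's `KitCore.ofKit_transport` BY NAME). ([IUTchI] Def 6.1 p.156) [claim: Mochizuki2012, status: disputed] -/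
theorem kitCoreThetaOfBadPairs_transport (x : D.IndexCopy)
    (f : (D.baseThetaDatumThetaOfBadPairs CG hS M hA hI B ΛBad ES).D ((D.kitCoreThetaOfBadPairs CG hS M hA hI B ΛBad ES).e x) ⟶
      (D.baseThetaDatumThetaOfBadPairs CG hS M hA hI B ΛBad ES).D ((D.kitCoreThetaOfBadPairs CG hS M hA hI B ΛBad ES).e x)) :
    ((D.kitCoreThetaOfBadPairs CG hS M hA hI B ΛBad ES).ambModel x).inv ≫ ((D.kitCoreThetaOfBadPairs CG hS M hA hI B ΛBad ES).amb x).map f ≫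
        ((D.kitCoreThetaOfBadPairs CG hS M hA hI B ΛBad ES).ambModel x).hom = f.hom :=
  BaseThetaDatum.KitCore.ofKit_transport (D.baseKitThetaNFOfBadPairs CG hS M hA hI B ΛBad) D.five_le_l D.indexCopy_not_mem_arc_of_mem_bad
    (D.nfKitThetaOfBadPairs CG hS M hA hI B ΛBad) (PMBaseKit.MonoBinder.tautological _) D.indexCopyBad_nonempty
    (D.evalBinderThetaNFOfBadPairs CG hS M hA hI B ΛBad D.five_le_l ES) x f

/-! ### §1. Proposition 6.7 AS PRINTED at the genuine-shape Θ-NF kit with parametric bad-pair data -/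

/-- **[IUTchI] Proposition 6.7 at the genuine-shape Θ-NF kit with parametric bad-pair data, Definition 4.6 (ii) AS TYPED IN §4** (p. 167 l. 22–29 «a functorial
algorithm for constructing a … `𝒟-Θ`-bridge `†𝔇_{T^⋇} → †𝔇_>` as in Definition 4.6, (ii)»): over the §4 datum `baseThetaDatumThetaOfBadPairs B ΛBad ES`
of the REAL initial Θ-data, for EVERY `𝒟-Θ^±`-bridge `B♭` of the genuine-shape Θ-NF kit (parametric bad-pair data) the output `B♭.thetaBridgeData _ _` of the algorithm —
formed with the multiplicative kit generated by the evaluation sections `ES` (Example 4.4 (i), (ii)) — is the image of an honest §4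
`𝒟-Θ`-bridge `B'` of abc-iut-L5-t3's `BaseThetaDatum.DThetaBridge`: index sets matched by `ι`, isomorphisms `κ`, `γ` of the constituent local
objects, conjugation by which carries the constituent poly-morphisms `†φ^Θ_{ι j, v̲}` of `B'` EXACTLY onto the output's (the comparison functor
is the inclusion of local objects, `f ↦ f.hom`).  abc-iut-L5-t3's `KitCore.thetaBridgeAlgorithm_dThetaBridge` (P67-L05) at abc-iut-L5-t4's
`thetaAgrees_thetaOfBadPairs ES`; `Odd l` is Def 3.1 (c) (`odd_l`).  DISPLAYED: {CG, hS, M, hA, hI} ∪ {B, ΛBad} ∪ {ES}.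
([IUTchI] Prop 6.7 p.167) [claim: Mochizuki2012, status: disputed] -/
theorem thetaBridgeAlgorithm_thetaOfBadPairs :
    PMBaseKit.DThetaPMBridge.ThetaBridgeAlgorithm (D.multKitThetaNFOfBadPairs CG hS M hA hI B ΛBad ES)
      (fun Dt => ∃ (B' : (D.baseThetaDatumThetaOfBadPairs CG hS M hA hI B ΛBad ES).DThetaBridge) (ι : Dt.J ≃ B'.J)
          (κ : ∀ j x, (B'.capsule (ι j) x).obj ≅ (Dt.capsule j).obj x)
          (γ : ∀ x, (B'.cod x).obj ≅ Dt.codomain.obj x),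
          ∀ j x, Dt.poly j x = {g | ∃ f ∈ B'.poly (ι j) x, g = (κ j x).inv ≫ f.hom ≫ (γ x).hom})
      D.odd_l :=
  BaseThetaDatum.KitCore.thetaBridgeAlgorithm_dThetaBridge (D.thetaAgrees_thetaOfBadPairs CG hS M hA hI B ΛBad ES) D.odd_l

/-- **[IUTchI] Prop 6.7, Def 4.6 (ii) in the KIT READING, at the genuine-shape Θ-NF kit with parametric bad-pair data** (abc-iut-w4-d054's predicate of p412223,
«there exist isomorphisms `𝔇_> ⥲ †𝔇_>`, `𝔇_⋇ ⥲ †𝔇_{T^⋇}`, conjugation by which maps `φ^Θ_⋇ ↦ †φ^Θ_⋇`»): the output at every `𝒟-Θ^±`-bridge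
admits a bijection `J ⥲ {1, …, l^⋇}` and isomorphisms `κ_j`, `δ` with `†φ^Θ_{j,v̲}` EXACTLY `κ_j⁻¹ ∘ φ^Θ_{v̲_j} ∘ δ` — the kit's class
(`thetaPolyBad`, here the saturated evaluation sections generated by `ES`) at bad `v̲`, the full poly-isomorphism at good `v̲`; the one
hypothesis `hbad` of p412223 (Ex 4.4 (ii) bi-invariance) is DISCHARGED through the core (abc-iut-L5-t3's `thetaBridgeAlgorithm_isModelConjugate`).
([IUTchI] Prop 6.7 p.167) [claim: Mochizuki2012, status: disputed] -/
theorem thetaBridgeAlgorithm_isModelConjugate_thetaOfBadPairs :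
    PMBaseKit.DThetaPMBridge.ThetaBridgeAlgorithm (D.multKitThetaNFOfBadPairs CG hS M hA hI B ΛBad ES)
      (fun Dt => ∃ (e : Dt.J ≃ Fin ((l - 1) / 2))
          (κ : ∀ j, (PMBaseKit.DStrip.model (D.baseKitThetaNFOfBadPairs CG hS M hA hI B ΛBad)).Iso (Dt.capsule j))
          (δ : (PMBaseKit.DStrip.model (D.baseKitThetaNFOfBadPairs CG hS M hA hI B ΛBad)).Iso Dt.codomain),
        (∀ (j : Dt.J) (x : D.IndexCopy) (hx : x ∈ D.indexCopyBad), Dt.poly j x =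
            {h | ∃ g ∈ (D.multKitThetaNFOfBadPairs CG hS M hA hI B ΛBad ES).thetaPolyBad (e j) x hx, h = (κ j x).inv ≫ g ≫ (δ x).hom}) ∧
        (∀ (j : Dt.J) (x : D.IndexCopy), x ∉ D.indexCopyBad → Dt.poly j x =
            {h | ∃ g : (D.baseKitThetaNFOfBadPairs CG hS M hA hI B ΛBad).model x ≅ (D.baseKitThetaNFOfBadPairs CG hS M hA hI B ΛBad).model x,
              h = (κ j x).inv ≫ g.hom ≫ (δ x).hom}))
      D.odd_l :=
  BaseThetaDatum.KitCore.thetaBridgeAlgorithm_isModelConjugate (D.thetaAgrees_thetaOfBadPairs CG hS M hA hI B ΛBad ES) D.odd_l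

/-- **Prop 6.7 at the genuine-shape Θ-NF kit with parametric bad-pair data with the printed labelling `T^⋇ ⥲ 𝔽_l^⋇`** (p. 167 with Def 4.6 (ii) p. 111): the
constituent of the output at the class `q ∈ T^⋇` is EXACTLY a conjugate of the MODEL poly-morphism `φ^Θ_{v̲_j}` of Example 4.4 (iv) of the
genuine §4 datum `baseThetaDatumThetaOfBadPairs B ΛBad ES` (`modelThetaBridge`: at bad `v̲` the Example-4.4 (i)(ii) evaluation sections of label `j`
— generated by `ES`, saturated under «composing with arbitrary isomorphisms» — at good `v̲` the full poly-isomorphism), `j = ofFin (starLabel q)`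
along abc-iut-L5-t4's canonical labelling of Def 6.4 (i); read through the identity dictionary.
([IUTchI] Prop 6.7 p.167) [claim: Mochizuki2012, status: disputed] -/
theorem thetaBridgeData_poly_eq_modelThetaBridge_thetaOfBadPairs (Bpm : (D.baseKitThetaNFOfBadPairs CG hS M hA hI B ΛBad).DThetaPMBridge) :
    ∃ (κ : ∀ (q : Bpm.grpT.AbsStar) (x : D.IndexCopy), (D.baseKitThetaNFOfBadPairs CG hS M hA hI B ΛBad).model x ≅ (Bpm.starCapsule q).obj x)
      (γ : ∀ x, (D.baseKitThetaNFOfBadPairs CG hS M hA hI B ΛBad).model x ≅ Bpm.codomain.obj x),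
      ∀ (q : Bpm.grpT.AbsStar) x, (Bpm.thetaBridgeData (D.multKitThetaNFOfBadPairs CG hS M hA hI B ΛBad ES) D.odd_l).poly (ULift.up q) x =
        {g | ∃ f ∈ (D.baseThetaDatumThetaOfBadPairs CG hS M hA hI B ΛBad ES).modelThetaBridge (FlStar.ofFin l (Bpm.starLabel D.odd_l q)) x,
          g = (κ q x).inv ≫ f.hom ≫ (γ x).hom} := by
  obtain ⟨κ, γ, h⟩ := BaseThetaDatum.KitCore.thetaBridgeData_poly_eq_transport_modelThetaBridge
    (D.thetaAgrees_thetaOfBadPairs CG hS M hA hI B ΛBad ES) D.odd_l Bpm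
  refine ⟨κ, γ, fun q x => (h q x).trans ?_⟩
  ext g
  constructor
  · rintro ⟨f, hf, rfl⟩
    exact ⟨f, hf, rfl⟩
  · rintro ⟨f, hf, rfl⟩
    exact ⟨f, hf, rfl⟩

/-- **The `isModel` clause of Def 4.6 (ii) for the outputs of Prop 6.7 at the genuine-shape Θ-NF kit with parametric bad-pair data, FIELD FOR FIELD** (Def 4.6 (ii)
p. 111): a bijection `ι : 𝔽_l^⋇ ⥲ T^⋇`, isomorphisms `κ_j : 𝒟_v̲ ⥲ †𝒟_{ι(j),v̲}`, `δ : 𝒟_v̲ ⥲ †𝒟_{>,v̲}`, with `†φ^Θ_{ι(j),v̲}` EXACTLY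
`κ_j⁻¹ ∘ φ^Θ_{v̲_j} ∘ δ` for the MODEL `φ^Θ_{v̲_j} = modelThetaBridge j v̲` of the genuine §4 datum (abc-iut-L5-t3's `KitCore.thetaBridgeData_isModel`,
the transport read away by `kitCoreThetaOfBadPairs_transport`). ([IUTchI] Def 4.6 (ii) p.111) [claim: Mochizuki2012, status: disputed] -/
theorem thetaBridgeData_isModel_thetaOfBadPairs (Bpm : (D.baseKitThetaNFOfBadPairs CG hS M hA hI B ΛBad).DThetaPMBridge) :
    ∃ (ι : FlStar l ≃ (Bpm.thetaBridgeData (D.multKitThetaNFOfBadPairs CG hS M hA hI B ΛBad ES) D.odd_l).J)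
      (κ : ∀ j, (PMBaseKit.DStrip.model (D.baseKitThetaNFOfBadPairs CG hS M hA hI B ΛBad)).Iso
        ((Bpm.thetaBridgeData (D.multKitThetaNFOfBadPairs CG hS M hA hI B ΛBad ES) D.odd_l).capsule (ι j)))
      (δ : (PMBaseKit.DStrip.model (D.baseKitThetaNFOfBadPairs CG hS M hA hI B ΛBad)).Iso
        (Bpm.thetaBridgeData (D.multKitThetaNFOfBadPairs CG hS M hA hI B ΛBad ES) D.odd_l).codomain),
      ∀ (j : FlStar l) (x : D.IndexCopy), (Bpm.thetaBridgeData (D.multKitThetaNFOfBadPairs CG hS M hA hI B ΛBad ES) D.odd_l).poly (ι j) x =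
        {h | ∃ f ∈ (D.baseThetaDatumThetaOfBadPairs CG hS M hA hI B ΛBad ES).modelThetaBridge j x, h = (κ j x).inv ≫ f.hom ≫ (δ x).hom} := by
  obtain ⟨ι, κ, δ, h⟩ := BaseThetaDatum.KitCore.thetaBridgeData_isModel (D.thetaAgrees_thetaOfBadPairs CG hS M hA hI B ΛBad ES) D.odd_l Bpm
  refine ⟨ι, κ, δ, fun j x => (h j x).trans ?_⟩
  ext g
  constructor
  · rintro ⟨f, hf, rfl⟩
    exact ⟨f, hf, by rw [kitCoreThetaOfBadPairs_transport]; rfl⟩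
  · rintro ⟨f, hf, rfl⟩
    exact ⟨f, hf, by rw [kitCoreThetaOfBadPairs_transport]; rfl⟩

/-- **«functorial … well-defined, up to a unique isomorphism», EXISTENCE, at the genuine-shape Θ-NF kit with parametric bad-pair data** (p. 167 l. 23 = Prop 4.8 (ii)
p. 115, existence half, read on the outputs): for ANY two `𝒟-Θ^±`-bridges of the kit the label-matching bijection of index sets underlies a
Def-4.6 (ii) isomorphism `†φ^Θ_⋆ ⥲ ‡φ^Θ_⋆` between the outputs (abc-iut-w5-d228's `thetaBridgeData_hom_nonempty`, kit-general, BY NAME).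
([IUTchI] Prop 6.7 p.167) [claim: Mochizuki2012, status: disputed] -/
theorem thetaBridgeData_hom_nonempty_thetaOfBadPairs (B₁ B₂ : (D.baseKitThetaNFOfBadPairs CG hS M hA hI B ΛBad).DThetaPMBridge) :
    Nonempty (PMBaseKit.DThetaBridgeData.Hom (B₁.thetaBridgeData (D.multKitThetaNFOfBadPairs CG hS M hA hI B ΛBad ES) D.odd_l)
      (B₂.thetaBridgeData (D.multKitThetaNFOfBadPairs CG hS M hA hI B ΛBad ES) D.odd_l)) :=
  PMBaseKit.DThetaPMBridge.thetaBridgeData_hom_nonempty (D.multKitThetaNFOfBadPairs CG hS M hA hI B ΛBad ES) D.odd_l B₁ B₂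

/-- **«well-defined, up to a UNIQUE isomorphism» at the genuine-shape Θ-NF kit with parametric bad-pair data** (p. 167 l. 23; Prop 4.8 (ii) p. 115 «of cardinality
one»): between the outputs of the algorithm at any two `𝒟-Θ^±`-bridges there is EXACTLY ONE Def-4.6 (ii) morphism — `Nat.card = 1`.  The
label-rigidity input is DERIVED through the core from the evaluation-section binders `ES` (abc-iut-L5-t3's `KitCore.card_thetaBridgeData_hom` at
`thetaAgrees_thetaOfBadPairs ES`), and the bad place it needs exists by Def 3.1 (b) (`indexCopyBad_nonempty`).  DISPLAYED: {CG, hS, M, hA, hI} ∪ {B, ΛBad} ∪ {ES}.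
([IUTchI] Prop 6.7 p.167) [claim: Mochizuki2012, status: disputed] -/
theorem card_thetaBridgeData_hom_thetaOfBadPairs (B₁ B₂ : (D.baseKitThetaNFOfBadPairs CG hS M hA hI B ΛBad).DThetaPMBridge) :
    Nat.card (PMBaseKit.DThetaBridgeData.Hom (B₁.thetaBridgeData (D.multKitThetaNFOfBadPairs CG hS M hA hI B ΛBad ES) D.odd_l)
      (B₂.thetaBridgeData (D.multKitThetaNFOfBadPairs CG hS M hA hI B ΛBad ES) D.odd_l)) = 1 := by
  obtain ⟨x, hx⟩ := D.indexCopyBad_nonempty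
  exact BaseThetaDatum.KitCore.card_thetaBridgeData_hom (D.thetaAgrees_thetaOfBadPairs CG hS M hA hI B ΛBad ES) D.odd_l hx B₁ B₂

/-- **The two readings of Def 4.6 (ii) AGREE at the genuine-shape Θ-NF kit with parametric bad-pair data**: `𝒟-Θ`-bridge data over the kit is a conjugate of the
kit-level model (the saturated evaluation sections `thetaPolyBad` generated by `ES` at bad `v̲`, the full poly-isomorphism at good `v̲`) iff it
is, place by place, the image of a §4 `𝒟-Θ`-bridge of abc-iut-L5-t3's Definition 4.6 (ii) over the genuine §4 datum (abc-iut-L5-t3's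
`KitCore.isModelConjugate_iff_exists_dThetaBridge` BY NAME). ([IUTchI] Def 4.6 (ii) p.111) [claim: Mochizuki2012, status: disputed] -/
theorem isModelConjugate_iff_exists_dThetaBridge_thetaOfBadPairs (Dt : (D.baseKitThetaNFOfBadPairs CG hS M hA hI B ΛBad).DThetaBridgeData) :
    (∃ (e : Dt.J ≃ Fin ((l - 1) / 2))
        (κ : ∀ j, (PMBaseKit.DStrip.model (D.baseKitThetaNFOfBadPairs CG hS M hA hI B ΛBad)).Iso (Dt.capsule j))
        (δ : (PMBaseKit.DStrip.model (D.baseKitThetaNFOfBadPairs CG hS M hA hI B ΛBad)).Iso Dt.codomain),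
        (∀ (j : Dt.J) (x : D.IndexCopy) (hx : x ∈ D.indexCopyBad), Dt.poly j x =
            {h | ∃ g ∈ (D.multKitThetaNFOfBadPairs CG hS M hA hI B ΛBad ES).thetaPolyBad (e j) x hx, h = (κ j x).inv ≫ g ≫ (δ x).hom}) ∧
        (∀ (j : Dt.J) (x : D.IndexCopy), x ∉ D.indexCopyBad → Dt.poly j x =
            {h | ∃ g : (D.baseKitThetaNFOfBadPairs CG hS M hA hI B ΛBad).model x ≅ (D.baseKitThetaNFOfBadPairs CG hS M hA hI B ΛBad).model x,
              h = (κ j x).inv ≫ g.hom ≫ (δ x).hom})) ↔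
    ∃ (B' : (D.baseThetaDatumThetaOfBadPairs CG hS M hA hI B ΛBad ES).DThetaBridge) (ι : Dt.J ≃ B'.J)
      (κ : ∀ j x, (B'.capsule (ι j) x).obj ≅ (Dt.capsule j).obj x)
      (γ : ∀ x, (B'.cod x).obj ≅ Dt.codomain.obj x),
      ∀ j x, Dt.poly j x = {g | ∃ f ∈ B'.poly (ι j) x, g = (κ j x).inv ≫ f.hom ≫ (γ x).hom} :=
  BaseThetaDatum.KitCore.isModelConjugate_iff_exists_dThetaBridge (D.thetaAgrees_thetaOfBadPairs CG hS M hA hI B ΛBad ES) Dt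

/-! ### §2. Non-vacuity of the universally quantified `𝒟-Θ^±`-bridge, and packaging -/

/-- **The quantifier `∀ B♭ : 𝒟-Θ^±-bridge` of Prop 6.7 is NOT VACUOUS over the genuine-shape Θ-NF kit (parametric bad-pair data)**: the model `𝒟-Θ^±`-bridge
`φ^{Θ±}_± : 𝔇_± → 𝔇_≻` of Example 6.2 (i) (abc-iut-L5-t4's `Ex62.bridge`) lives over every base kit, in particular over this one.
([IUTchI] Ex 6.2 (i) p.160) [claim: Mochizuki2012, status: disputed] -/
theorem nonempty_dThetaPMBridge_thetaOfBadPairs : Nonempty (D.baseKitThetaNFOfBadPairs CG hS M hA hI B ΛBad).DThetaPMBridge :=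
  haveI : NeZero l := ⟨(Fact.out : l.Prime).ne_zero⟩
  ⟨PMBaseKit.Ex62.bridge _⟩

/-- **Prop 6.7 APPLIED to the model `𝒟-Θ^±`-bridge of Example 6.2 (i) over the genuine-shape Θ-NF kit with parametric bad-pair data**: the algorithm's output
`†φ^Θ_⋇ : †𝔇_{T^⋇} → †𝔇_>` at `φ^{Θ±}_±` IS, place by place, the image of a §4 `𝒟-Θ`-bridge of Definition 4.6 (ii) over the genuine §4 datum
— a closed instance with no bridge variable left. ([IUTchI] Prop 6.7 p.167) [claim: Mochizuki2012, status: disputed] -/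
theorem exists_dThetaBridge_ex62_thetaOfBadPairs :
    haveI : NeZero l := ⟨(Fact.out : l.Prime).ne_zero⟩
    ∃ (B' : (D.baseThetaDatumThetaOfBadPairs CG hS M hA hI B ΛBad ES).DThetaBridge)
      (ι : ((PMBaseKit.Ex62.bridge (D.baseKitThetaNFOfBadPairs CG hS M hA hI B ΛBad)).thetaBridgeData
          (D.multKitThetaNFOfBadPairs CG hS M hA hI B ΛBad ES) D.odd_l).J ≃ B'.J)
      (κ : ∀ j x, (B'.capsule (ι j) x).obj ≅
        (((PMBaseKit.Ex62.bridge (D.baseKitThetaNFOfBadPairs CG hS M hA hI B ΛBad)).thetaBridgeData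
          (D.multKitThetaNFOfBadPairs CG hS M hA hI B ΛBad ES) D.odd_l).capsule j).obj x)
      (γ : ∀ x, (B'.cod x).obj ≅
        ((PMBaseKit.Ex62.bridge (D.baseKitThetaNFOfBadPairs CG hS M hA hI B ΛBad)).thetaBridgeData
          (D.multKitThetaNFOfBadPairs CG hS M hA hI B ΛBad ES) D.odd_l).codomain.obj x),
      ∀ j x, ((PMBaseKit.Ex62.bridge (D.baseKitThetaNFOfBadPairs CG hS M hA hI B ΛBad)).thetaBridgeData
          (D.multKitThetaNFOfBadPairs CG hS M hA hI B ΛBad ES) D.odd_l).poly j x =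
        {g | ∃ f ∈ B'.poly (ι j) x, g = (κ j x).inv ≫ f.hom ≫ (γ x).hom} :=
  D.thetaBridgeAlgorithm_thetaOfBadPairs CG hS M hA hI B ΛBad ES _

/-- **Existential packaging for certificates** (node IUTchI:Prop6.7; the shape of (C″)'s `exists_kitCore_thetaAgrees_thetaOfBadPairs` extended by
the printed conclusion): over the genuine-shape Θ-NF kit (parametric bad-pair data `B`, laws `ΛBad`) of the REAL initial Θ-data there EXIST a core agreement with the genuine §4 datum and a
multiplicative kit such that law (γ) holds AND Prop 6.7 holds with Def 4.6 (ii) as typed in §4 — DISPLAYED {CG, hS, M, hA, hI} ∪ {B, ΛBad} ∪ {ES}.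
([IUTchI] Prop 6.7 p.167) [claim: Mochizuki2012, status: disputed] -/
theorem exists_kitCore_thetaAgrees_thetaBridgeAlgorithm_thetaOfBadPairs :
    ∃ (c : (D.baseThetaDatumThetaOfBadPairs CG hS M hA hI B ΛBad ES).KitCore (D.baseKitThetaNFOfBadPairs CG hS M hA hI B ΛBad))
      (Mk : (D.baseKitThetaNFOfBadPairs CG hS M hA hI B ΛBad).MultKit), c.ThetaAgrees Mk ∧
      PMBaseKit.DThetaPMBridge.ThetaBridgeAlgorithm Mk
        (fun Dt => ∃ (B' : (D.baseThetaDatumThetaOfBadPairs CG hS M hA hI B ΛBad ES).DThetaBridge) (ι : Dt.J ≃ B'.J)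
            (κ : ∀ j x, (c.amb x).obj (B'.capsule (ι j) (c.e x)) ≅ (Dt.capsule j).obj x)
            (γ : ∀ x, (c.amb x).obj (B'.cod (c.e x)) ≅ Dt.codomain.obj x),
            ∀ j x, Dt.poly j x = {g | ∃ f ∈ B'.poly (ι j) (c.e x), g = (κ j x).inv ≫ (c.amb x).map f ≫ (γ x).hom})
        D.odd_l :=
  ⟨D.kitCoreThetaOfBadPairs CG hS M hA hI B ΛBad ES, D.multKitThetaNFOfBadPairs CG hS M hA hI B ΛBad ES, D.thetaAgrees_thetaOfBadPairs CG hS M hA hI B ΛBad ES,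
    BaseThetaDatum.KitCore.thetaBridgeAlgorithm_dThetaBridge (D.thetaAgrees_thetaOfBadPairs CG hS M hA hI B ΛBad ES) D.odd_l⟩

end InitialThetaData

end KitCoreThetaOfBadPairsProp67

end Literature.IUT.HodgeTheaters
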